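import Summits.QuantumFields.YangMills.Theorems.FlatTubeReductionKernelParityExp
import HarnessLib

/-!
# Kernel parity, FLOOR direction: `K₂ = K₁·exp(A + R)` with `A` odd ⇒ `⟨f,K₂f⟩ ≥ ⟨f,K₁f⟩ − ρ·M₁·‖f‖²` for even `f ≥ 0` — the floor with rate loses only second order;
# and the uniform relative bound that feeds the STIFF / CROSS transfers
# (route `FlatTubeReduction`, crux K1 `NearFlatRatioLaw` stmt-QuantumFields-24720, registered stub `stub_boRate` = FCL 23943's `BORateAll`; line «borate»;
# rung R2b1 = RECORD-label femto gap; no summit statement is proved here)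

Seat `ym-line-ftr-p1` g7 (prover).  The door `innerRateAt_of_bo` (p599058) needs a FLOOR WITH RATE `N·μ₀·e^{−C u²} ≤ λ₀`: the Rayleigh quotient of the
`k = 0` trial state must be controlled from BELOW at relative precision `O(u²)`.  With the true kernel written as `K₂ = K₁·exp(A + R)` (`K₁` the even c-frozen
fibred model, `A` the ODD first-order part of size `a ≍ β^{-1/2}·polylog ≫ u²`, `R` the even remainder `|R| ≤ ρ = O(β^{-1}·polylog)`), the uniform comparison
`form_ge_of_kernel_near` (lane A) would lose `2(a + ρ)` — first order.  Parity removes the loss: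
* ★★ `form_ge_of_exp_near_odd` — `K₁ ≥ 0` symmetric `ι`-even with rows `≤ M₁`, `A` `ι`-odd, `|R| ≤ ρ`; `f ≥ 0` `ι`-even ⇒
  `∫∫ f K₁ f − ρ·M₁·∫f² ≤ ∫∫ f K₂ f` (from `exp x ≥ 1 + x` pointwise, the odd term integrating to zero, Schur on the `R`-term) — NO smallness of `a` needed at all;
* ★ `kernel_near_of_exp` — the UNIFORM relative bound `|K₂ − K₁| ≤ 2(a + ρ)·K₁` (`a + ρ ≤ 1`), in the shape `hnear` of lane A's `…InnerKernelComparison`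
  (`abs_form_sub_le_of_kernel_near`, `abs_bilin_sub_le_of_kernel_near`, s = 1): enough for the STIFF block (P3) (tolerates any fixed fraction of the gap) and the
  CROSS block (P4) (amplitude `O(a) = O(β^{-1/2+}) ≤ O(u)`), where parity is neither available (`χ` is not even) nor needed.
With `…KernelParityExp` (DIAG, p637527) this completes the true-vs-model transfer of all door clauses at rate grade, given the exponent split `A + R`
(`Cruxes/NearFlatRatioLaw/Lines/borate-rate-uniformity-g7.md`).
HONEST FRAMING: elementary real analysis/measure theory for the registered stub of a crux of the CONDITIONAL reduction route to the femto rung R2b1 (RECORD label);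
the chart supplying `K₁, A, R, ι` is OPEN (route RED lane A C4-CORE (d) + the rate twin); nothing here is infinite volume, a continuum limit or the Clay mass gap.
No definitions, no `sorry`.

## References
* B. Helffer, *Spectral Theory and its Applications*, CUP 2013, Lemma 7.1 (Schur's test) — [cite: Helffer2013, Lemma 7.1 pp.77–78].
* M. Lüscher, Nucl. Phys. B219 (1983) 233, §3 (parity of the cubic vertex in the constant-mode expansion) — [cite: Luscher1983, §3].
-/

set_option autoImplicit false

noncomputable section

open MeasureTheory

namespace Summit.QuantumFields.YangMills.Theorems.FemtoTransferGap.KernelParity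

open Literature.Analysis.OperatorTheory

/-- ★ **Uniform relative bound from the exponent split**: `0 ≤ K₁`, `K₂ = K₁·exp(A + R)`, `|A| ≤ a`, `|R| ≤ ρ`, `a + ρ ≤ 1` ⇒
`|K₂ − 1·K₁| ≤ (2(a + ρ))·1·K₁` pointwise — the hypothesis `hnear` (with `s = 1`, `η = 2(a+ρ)`) of lane A's `abs_form_sub_le_of_kernel_near` /
`abs_bilin_sub_le_of_kernel_near` (Mathlib's `Real.abs_exp_sub_one_le`: `|x| ≤ 1 ⇒ |exp x − 1| ≤ 2|x|`). [folklore] -/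
theorem kernel_near_of_exp {X : Type*} {K₁ K₂ A R : X → X → ℝ} {a ρ : ℝ} (hK₁ : ∀ x y, 0 ≤ K₁ x y)
    (hK₂ : ∀ x y, K₂ x y = K₁ x y * Real.exp (A x y + R x y)) (hA : ∀ x y, |A x y| ≤ a) (hR : ∀ x y, |R x y| ≤ ρ) (h1 : a + ρ ≤ 1) :
    ∀ x y, |K₂ x y - 1 * K₁ x y| ≤ (2 * (a + ρ)) * 1 * K₁ x y := by
  intro x y
  have hsum : |A x y + R x y| ≤ a + ρ := (abs_add_le _ _).trans (add_le_add (hA x y) (hR x y))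
  have hexp : |Real.exp (A x y + R x y) - 1| ≤ 2 * (a + ρ) :=
    (Real.abs_exp_sub_one_le (hsum.trans h1)).trans (by linarith)
  have e : K₂ x y - 1 * K₁ x y = K₁ x y * (Real.exp (A x y + R x y) - 1) := by rw [hK₂]; ring
  rw [e, abs_mul, abs_of_nonneg (hK₁ x y), mul_one, mul_comm]
  exact mul_le_mul_of_nonneg_right hexp (hK₁ x y)

/-- Pointwise lower bound behind the floor: `0 ≤ K₁`, `K₂ = K₁·exp(A + R)`, `|R| ≤ ρ`, `0 ≤ φ` (think `φ = f(x)f(y)`) ⇒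
`φ·K₁ + φ·K₁·A − ρ·(φ·K₁) ≤ φ·K₂` (`exp t ≥ 1 + t`). [folklore] -/
theorem mul_kernel_ge_of_exp {X : Type*} {K₁ K₂ A R : X → X → ℝ} {ρ : ℝ} (hK₁ : ∀ x y, 0 ≤ K₁ x y)
    (hK₂ : ∀ x y, K₂ x y = K₁ x y * Real.exp (A x y + R x y)) (hR : ∀ x y, |R x y| ≤ ρ) {φ : ℝ} (hφ : 0 ≤ φ) (x y : X) :
    φ * K₁ x y + φ * (K₁ x y * A x y) - ρ * (φ * K₁ x y) ≤ φ * K₂ x y := by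
  have h1 : 1 + (A x y + R x y) ≤ Real.exp (A x y + R x y) := by
    have := Real.add_one_le_exp (A x y + R x y); linarith
  have h2 : -ρ ≤ R x y := (abs_le.mp (hR x y)).1
  have hφK : 0 ≤ φ * K₁ x y := mul_nonneg hφ (hK₁ x y)
  rw [hK₂]
  have h3 : φ * K₁ x y * (1 + (A x y + R x y)) ≤ φ * K₁ x y * Real.exp (A x y + R x y) := mul_le_mul_of_nonneg_left h1 hφK
  have h4 : φ * K₁ x y * (1 + (A x y + -ρ)) ≤ φ * K₁ x y * (1 + (A x y + R x y)) := by
    refine mul_le_mul_of_nonneg_left ?_ hφK; linarith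
  nlinarith

variable {X : Type*} [MeasurableSpace X] {μ : Measure X} [SFinite μ]

/-- ★★ **FLOOR with rate by parity.**  `K₁ ≥ 0` symmetric, `ι`-even, rows `≤ M₁`; `K₂ = K₁·exp(A + R)` with `A` `ι`-odd and `|R| ≤ ρ` (`0 ≤ ρ`); `f ≥ 0` and `ι`-even
(with product-integrability side conditions).  Then `∫∫ f K₁ f − ρ·M₁·∫f² ≤ ∫∫ f K₂ f`: the Rayleigh quotient of an even nonnegative trial state is bounded BELOW by its
model value minus a SECOND-order term — the odd first-order part `A`, however large, costs nothing (`exp t ≥ 1 + t`, then `∫∫ fK₁Af = 0`).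
[cite: Helffer2013, Lemma 7.1 pp.77–78] [cite: Luscher1983, §3] -/
theorem form_ge_of_exp_near_odd (ι : X ≃ᵐ X) (hι : MeasurePreserving ι μ μ)
    {K₁ K₂ A R : X → X → ℝ} {ρ M₁ : ℝ} (hρ : 0 ≤ ρ) (hK₁ : ∀ x y, 0 ≤ K₁ x y)
    (hsymm : ∀ x y, K₁ x y = K₁ y x) (hrow : ∀ᵐ x ∂μ, ∫ y, K₁ x y ∂μ ≤ M₁)
    (hK₁ι : ∀ x y, K₁ (ι x) (ι y) = K₁ x y) (hAι : ∀ x y, A (ι x) (ι y) = -A x y)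
    (hK₂ : ∀ x y, K₂ x y = K₁ x y * Real.exp (A x y + R x y)) (hR : ∀ x y, |R x y| ≤ ρ)
    {f : X → ℝ} (hfι : ∀ x, f (ι x) = f x) (hf0 : ∀ x, 0 ≤ f x) (hf : Integrable (fun x => f x ^ 2) μ)
    (hI2 : Integrable (fun p : X × X => f p.1 * K₂ p.1 p.2 * f p.2) (μ.prod μ))
    (hIA : Integrable (fun p : X × X => f p.1 * (K₁ p.1 p.2 * A p.1 p.2) * f p.2) (μ.prod μ))
    (hIs : Integrable (fun p : X × X => f p.1 * K₁ p.1 p.2 * f p.2) (μ.prod μ))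
    (hI₁ : Integrable (fun p : X × X => K₁ p.1 p.2 * f p.1 ^ 2) (μ.prod μ))
    (hI₂ : Integrable (fun p : X × X => K₁ p.1 p.2 * f p.2 ^ 2) (μ.prod μ)) :
    (∫ x, ∫ y, f x * K₁ x y * f y ∂μ ∂μ) - ρ * M₁ * ∫ x, f x ^ 2 ∂μ ≤ ∫ x, ∫ y, f x * K₂ x y * f y ∂μ ∂μ := by
  -- Schur bound for the (nonnegative) model form
  have hSchur : ∫ x, ∫ y, f x * K₁ x y * f y ∂μ ∂μ ≤ M₁ * ∫ x, f x ^ 2 ∂μ :=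
    SchurTest.integral_integral_mul_kernel_mul_self_le_of_symm (μ := μ) K₁ f hK₁ hsymm hrow hf hIs hI₁ hI₂
  -- the odd term integrates to zero
  have hodd : ∫ p, f p.1 * (K₁ p.1 p.2 * A p.1 p.2) * f p.2 ∂(μ.prod μ) = 0 :=
    integral_prod_eq_zero_of_odd ι hι (F := fun p : X × X => f p.1 * (K₁ p.1 p.2 * A p.1 p.2) * f p.2) fun x y => by
      dsimp only
      rw [hfι, hfι, hK₁ι, hAι]
      ring
  -- pointwise lower bound and integration over the product
  have hpt : ∀ p : X × X, (f p.1 * K₁ p.1 p.2 * f p.2 + f p.1 * (K₁ p.1 p.2 * A p.1 p.2) * f p.2) - ρ * (f p.1 * K₁ p.1 p.2 * f p.2)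
      ≤ f p.1 * K₂ p.1 p.2 * f p.2 := by
    intro p
    have h := mul_kernel_ge_of_exp hK₁ hK₂ hR (mul_nonneg (hf0 p.1) (hf0 p.2)) p.1 p.2
    have e1 : f p.1 * K₁ p.1 p.2 * f p.2 = (f p.1 * f p.2) * K₁ p.1 p.2 := by ring
    have e2 : f p.1 * (K₁ p.1 p.2 * A p.1 p.2) * f p.2 = (f p.1 * f p.2) * (K₁ p.1 p.2 * A p.1 p.2) := by ring
    have e3 : f p.1 * K₂ p.1 p.2 * f p.2 = (f p.1 * f p.2) * K₂ p.1 p.2 := by ring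
    rw [e1, e2, e3]
    exact h
  have hadd : Integrable (fun p : X × X => f p.1 * K₁ p.1 p.2 * f p.2 + f p.1 * (K₁ p.1 p.2 * A p.1 p.2) * f p.2) (μ.prod μ) := hIs.add hIA
  have hsm : Integrable (fun p : X × X => ρ * (f p.1 * K₁ p.1 p.2 * f p.2)) (μ.prod μ) := hIs.const_mul ρ
  have hL : Integrable (fun p : X × X => (f p.1 * K₁ p.1 p.2 * f p.2 + f p.1 * (K₁ p.1 p.2 * A p.1 p.2) * f p.2)
      - ρ * (f p.1 * K₁ p.1 p.2 * f p.2)) (μ.prod μ) := hadd.sub hsm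
  have hint := integral_mono hL hI2 hpt
  rw [integral_sub hadd hsm, integral_add hIs hIA, hodd, add_zero, integral_const_mul] at hint
  rw [← integral_prod _ hI2, ← integral_prod _ hIs]
  have hpos : ρ * ∫ p, f p.1 * K₁ p.1 p.2 * f p.2 ∂(μ.prod μ) ≤ ρ * M₁ * ∫ x, f x ^ 2 ∂μ := by
    rw [integral_prod _ hIs, mul_assoc]
    exact mul_le_mul_of_nonneg_left hSchur hρ
  linarith

end Summit.QuantumFields.YangMills.Theorems.FemtoTransferGap.KernelParity

end
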